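import Summits.CriticalPhenomena.SAWScalingLimit.Theses.SAWDevelopingMap
import Summits.CriticalPhenomena.SAWScalingLimit.Theses.SAWResidueField
import Summits.CriticalPhenomena.SAWScalingLimit.Theorems.SAWDevelopingMapHexTightOnFrontierFar
import HarnessLib

/-!
# Line `reversal-virgin-disc` — skeleton r9 for the crux `HexTight` (stmt-CriticalPhenomena-5423)

Seat c4 (`prover-line-stmt-CriticalPhenomena-5423-c4-0`), 2026-08-16, skeleton owner after seat c3; re-registered UNCHANGED by
seat c5 (`prover-line-stmt-CriticalPhenomena-5423-c5-0`, 2026-08-16T18:45Z): no reshape is warranted — the two registered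
stubs are the law-level AND-split of the crux (`HexTight_iff_pieces_far`) resp. its weakest known lattice-sufficient
form, both research-open (seat c5 audit: crux `NOTES.md` §Seat c5).

History. r7 (c2) derived `HexTight` from `ArcPinchBound` + `OnFrontierPerShellTight`; r8 (c3) weakened the
interior atom to `PinchDecay` (some threshold `k`, some rate `o(t)`, uniform over virgin discs) with the glue
`stub_arcTightOfPinchDecay` (p114652) / `stub_rootedTightOfPinchDecay` (p115969) landed; c4 landed the whole r8
composition as sorry-free conditional theorems under `Theorems/SAWDevelopingMapHexTightOfAtoms.lean` (p118066:
`hexTight_of_pinchDecay_of_onFrontierPerShellTight`, `interiorThinPerShellTight_of_pinchDecay`, …).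

r9 (this file) sharpens the BOUNDARY atom: the marked points are idle. `stub_onFrontierFarPerShellTight` asks
per-shell rate-free tightness of the traversal number only on thin shells `D(x; ρ, R)` centred at a point `x` of the
Jordan curve whose closed outer disc contains NEITHER marked point (`R < dist x (D.pt i)`, `i = 0, 1`): the shells
on which no traversal is forced by the endpoints. The reduction `OnFrontierFar ∧ InteriorThin ⇒ OnFrontier` is the
Aizenman–Burchard net localization with a DODGE: among the outer radii `R, R/5, R/25` of the sub-shells
`D(x; ρ, R')` one has both marked distances `dᵢ = dist x (D.pt i)` off the window
`((3R' + 13ρ)/16, (13R' + 3ρ)/16)` (the windows of radii in ratio `≥ 5` are disjoint), and then every frontier net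
shell `D(x''; 11w, (R' - ρ)/4)` of the localization of `D(x; ρ, R')` (`|dist x'' x - (ρ+R')/2| ≤ 10w`,
`88w < (R'-ρ)/2`) misses both marked points. This needs the net lemma with the frontier hypothesis asked only of
frontier points NEAR THE MIDDLE CIRCLE — `stub_netNear`, a provable variant of the landed
`BoundaryOnFrontier.perShellTight_thin_of_net` (p117056) — and costs aspect `100` at the target shell, which
`perShellTight_thin_of_onFrontierAspect` (p117056) removes.

Registered stubs (r9): `stub_pinchDecay` (OPEN interior atom, held by the lead) and `stub_onFrontierFarPerShellTight`
(OPEN boundary atom, far-from-marks form — still a verbatim piece of the crux by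
`BoundaryOnFrontier.perShellTight_of_hexTight`); the glue `stub_netNear` LANDED in wave 2 (p118567) and is imported.
Composition
`HexTight_of : PinchDecay → OnFrontierFarPerShellTight → HexTight` is exactly the landed
`BoundaryOnFrontier.hexTight_of_pinchDecay_of_onFrontierFar` (p118802: `interiorThinPerShellTight_of_pinchDecay` p118066,
the dodge over `stub_netNear` p118567, `perShellTight_thin_of_onFrontierAspect` p117056,
`hexTight_of_interiorThin_of_onFrontier` p107072); `HexTight_iff_pieces_far` records the landed sharpened equivalence
`HexTight ⟺ InteriorThin ∧ OnFrontierFar`. STUCK: `stub_pinchDecay`, `stub_onFrontierFarPerShellTight` (research-open a-priori multi-traversal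
estimates for the critical hexagonal SAW, pinned at two endpoints: Aizenman–Burchard (H1) in the interior / at the
Jordan curve).
-/

noncomputable section

open scoped BigOperators Classical ENNReal NNReal
open MeasureTheory Filter Topology Set Metric
open Literature.Probability.LatticeModels Literature.Probability.RandomPlanarGeometry
  Literature.Probability.RandomPlanarGeometry.SAW
open Summit.CriticalPhenomena.SAWScalingLimit.Theorems.HexTight.Reversal
open Summit.CriticalPhenomena.SAWScalingLimit.Theorems.HexTight.ExponentBootstrap
open Summit.CriticalPhenomena.SAWScalingLimit.Theorems.HexTight.BoundaryOnFrontier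

namespace Summit.CriticalPhenomena.SAWScalingLimit.Cruxes.HexTight.ReversalVirginDisc

/-! ## Named statements -/

/-- **INTERIOR ATOM, weakest lattice-local form: PINCH DECAY** (r8). For some threshold `k`, some nonnegative rate
function `φ` with `φ(t) = o(t)` as `t → 0⁺`, and some `N₀ > 0`: uniformly over configurations `(H, Λ)` virgin at
radius `N ≥ N₀` about `z₀` (arbitrary exterior) and rim doors `w, w'`, and for `1 ≤ η ≤ N/4`, the `H`-arcs of `Λ`
from `w` to `w'` whose polyline makes `k` separate traversals of `D(z₀; η, N/2)` carry at most `φ(η/N)` of the arc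
mass. (Aizenman–Burchard (H1) at ONE threshold with a rate just better than linear; heuristic value for the
critical `n = 0` model at threshold `2j`: `(η/N)^{x_{2j}}`, `x_{2j} = (9j² - 1)/12`, e.g. `35/12` at `k = 4`.) -/
def PinchDecay : Prop :=
  ∃ (k : ℕ) (φ : ℝ → ℝ) (N₀ : ℝ), 1 ≤ k ∧ 0 < N₀ ∧ (∀ t : ℝ, 0 ≤ φ t) ∧
    (∀ ε : ℝ, 0 < ε → ∃ t₀ : ℝ, 0 < t₀ ∧ ∀ t : ℝ, 0 < t → t ≤ t₀ → φ t ≤ ε * t) ∧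
    ∀ (H : SimpleGraph HexVertex) (Λ : Finset HexVertex) (z₀ : ℂ) (η N : ℝ)
      (w w' : Sym2 HexVertex), N₀ ≤ N → 1 ≤ η → η ≤ N / 4 →
      IsVirgin H Λ z₀ N → Straddles Λ z₀ N w → Straddles Λ z₀ N w' →
      travMass H Λ w w' k z₀ η (N / 2) ≤ φ (η / N) * arcMass H Λ w w'

/-- **INTERIOR ATOM, law-level form** (`InteriorThinPerShellTight`): per-shell rate-free tightness of the traversal
number on thin shells `D(x; ρ, R)`, `4ρ < R ≤ 1`, whose closed outer disc lies in the domain. A verbatim piece of the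
crux (`BoundaryOnFrontier.perShellTight_of_hexTight`); implied by `PinchDecay`
(`Reversal.interiorThinPerShellTight_of_pinchDecay`, p118066). -/
def InteriorThinPerShellTight : Prop :=
  ∀ (D : DobrushinDomain) (a b : ℝ → HexVertex), IsEmbEndpointApprox hexGraph hexCenter D a b →
    ∀ (x : ℂ) (ρ R : ℝ), 0 < ρ → 4 * ρ < R → R ≤ 1 → Metric.closedBall x R ⊆ D.carrier → ∀ η : ℝ, 0 < η →
      ∃ (k : ℕ) (δ₁ : ℝ), 0 < δ₁ ∧ ∀ δ ∈ Set.Ioc (0 : ℝ) δ₁, δ ≤ ρ →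
        hexSAWLaw D.carrier δ (a δ) (b δ)
          {γ | (⟨γ.walk.toCurve fun v => (δ : ℂ) * hexCenter v⟩ : Curve ℂ).HasTraversals k x ρ R} ≤
          ENNReal.ofReal η

/-- **BOUNDARY ATOM** (`OnFrontierPerShellTight`, seat c2, r7–r8): per-shell rate-free tightness of the traversal
number on thin shells centred at a point of the Jordan curve `frontier D.carrier`. -/
def OnFrontierPerShellTight : Prop :=
  ∀ (D : DobrushinDomain) (a b : ℝ → HexVertex), IsEmbEndpointApprox hexGraph hexCenter D a b →
    ∀ (x : ℂ) (ρ R : ℝ), 0 < ρ → 4 * ρ < R → R ≤ 1 → x ∈ frontier D.carrier → ∀ η : ℝ, 0 < η →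
      ∃ (k : ℕ) (δ₁ : ℝ), 0 < δ₁ ∧ ∀ δ ∈ Set.Ioc (0 : ℝ) δ₁, δ ≤ ρ →
        hexSAWLaw D.carrier δ (a δ) (b δ)
          {γ | (⟨γ.walk.toCurve fun v => (δ : ℂ) * hexCenter v⟩ : Curve ℂ).HasTraversals k x ρ R} ≤
          ENNReal.ofReal η

/-- **BOUNDARY ATOM, far-from-marks form** (`OnFrontierFarPerShellTight`, r9): the same, asked only of shells whose
closed outer disc contains neither marked point `D.pt 0`, `D.pt 1` (the limits of the endpoints `a δ`, `b δ`), i.e.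
of shells on which the endpoints force no traversal. -/
def OnFrontierFarPerShellTight : Prop :=
  ∀ (D : DobrushinDomain) (a b : ℝ → HexVertex), IsEmbEndpointApprox hexGraph hexCenter D a b →
    ∀ (x : ℂ) (ρ R : ℝ), 0 < ρ → 4 * ρ < R → R ≤ 1 → x ∈ frontier D.carrier →
      R < dist x (D.pt 0) → R < dist x (D.pt 1) → ∀ η : ℝ, 0 < η →
      ∃ (k : ℕ) (δ₁ : ℝ), 0 < δ₁ ∧ ∀ δ ∈ Set.Ioc (0 : ℝ) δ₁, δ ≤ ρ →
        hexSAWLaw D.carrier δ (a δ) (b δ)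
          {γ | (⟨γ.walk.toCurve fun v => (δ : ℂ) * hexCenter v⟩ : Curve ℂ).HasTraversals k x ρ R} ≤
          ENNReal.ofReal η

/-- **NET LOCALIZATION NEAR THE MIDDLE CIRCLE** (`NetNear`, r9 glue): the landed master localization
`BoundaryOnFrontier.perShellTight_thin_of_net` with its frontier hypothesis asked only of frontier points `x''` in
the closed `10w`-neighbourhood of the middle circle `dist x'' x ∈ [m - 10w, m + 10w]` (`m = (ρ+R)/2`,
`w = 2πm/M`) — the only frontier points the proof visits (`exists_frontier_near` about a net point `c_j`,
`dist c_j x = m`). -/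
def NetNear : Prop :=
  ∀ (Ω : Set ℂ), IsOpen Ω → ∀ (a b : ℝ → HexVertex),
    (∀ (x : ℂ) (ρ R : ℝ), 0 < ρ → 4 * ρ < R → R ≤ 1 → Metric.closedBall x R ⊆ Ω → ∀ η : ℝ, 0 < η →
      ∃ (k : ℕ) (δ₁ : ℝ), 0 < δ₁ ∧ ∀ δ ∈ Set.Ioc (0 : ℝ) δ₁, δ ≤ ρ →
        hexSAWLaw Ω δ (a δ) (b δ)
          {γ | (⟨γ.walk.toCurve fun v => (δ : ℂ) * hexCenter v⟩ : Curve ℂ).HasTraversals k x ρ R} ≤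
          ENNReal.ofReal η) →
    ∀ (x : ℂ) (ρ R : ℝ), 0 < ρ → 4 * ρ < R → R ≤ 1 →
      ∀ (M : ℕ), 176 * Real.pi * ((ρ + R) / 2) / ((R - ρ) / 2) < M → ∀ (β η₁ : ℝ), 0 ≤ β → 0 < η₁ →
      (∀ x'' ∈ frontier Ω,
        (ρ + R) / 2 - 10 * (2 * Real.pi * ((ρ + R) / 2) / M) ≤ dist x'' x →
        dist x'' x ≤ (ρ + R) / 2 + 10 * (2 * Real.pi * ((ρ + R) / 2) / M) →
        ∃ (k : ℕ) (δ₁ : ℝ), 0 < δ₁ ∧ ∀ δ ∈ Set.Ioc (0 : ℝ) δ₁,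
          δ ≤ 11 * (2 * Real.pi * ((ρ + R) / 2) / M) →
          hexSAWLaw Ω δ (a δ) (b δ)
            {γ | (⟨γ.walk.toCurve fun v => (δ : ℂ) * hexCenter v⟩ : Curve ℂ).HasTraversals k x''
              (11 * (2 * Real.pi * ((ρ + R) / 2) / M)) ((R - ρ) / 4)} ≤ ENNReal.ofReal β) →
      ∃ (k : ℕ) (δ₁ : ℝ), 0 < δ₁ ∧ ∀ δ ∈ Set.Ioc (0 : ℝ) δ₁,
        hexSAWLaw Ω δ (a δ) (b δ)
          {γ | (⟨γ.walk.toCurve fun v => (δ : ℂ) * hexCenter v⟩ : Curve ℂ).HasTraversals k x ρ R} ≤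
          ENNReal.ofReal (η₁ + M * β)

/-! ## Registered stubs (r9) — signatures INLINE over the objects -/

/-- **stub C' — PINCH DECAY** (`= PinchDecay`; THE open interior atom; size XL; held by the lead). -/
theorem stub_pinchDecay :
    ∃ (k : ℕ) (φ : ℝ → ℝ) (N₀ : ℝ), 1 ≤ k ∧ 0 < N₀ ∧ (∀ t : ℝ, 0 ≤ φ t) ∧
      (∀ ε : ℝ, 0 < ε → ∃ t₀ : ℝ, 0 < t₀ ∧ ∀ t : ℝ, 0 < t → t ≤ t₀ → φ t ≤ ε * t) ∧
      ∀ (H : SimpleGraph HexVertex) (Λ : Finset HexVertex) (z₀ : ℂ) (η N : ℝ)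
        (w w' : Sym2 HexVertex), N₀ ≤ N → 1 ≤ η → η ≤ N / 4 →
        IsVirgin H Λ z₀ N → Straddles Λ z₀ N w → Straddles Λ z₀ N w' →
        travMass H Λ w w' k z₀ η (N / 2) ≤ φ (η / N) * arcMass H Λ w w' := by
  sorry

/-- **stub N — NET LOCALIZATION NEAR THE MIDDLE CIRCLE** — LANDED (wave 2, p118567,
`Theorems/SAWDevelopingMapHexTightNetNear.lean`): `BoundaryOnFrontier.stub_netNear`. -/
theorem glue_netNear : NetNear :=
  Summit.CriticalPhenomena.SAWScalingLimit.Theorems.HexTight.BoundaryOnFrontier.stub_netNear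

/-- **stub G'' — ON-FRONTIER PER-SHELL TIGHTNESS FAR FROM THE MARKED POINTS** (`= OnFrontierFarPerShellTight`;
THE open boundary atom of r9; size L–XL; a verbatim piece of the crux). -/
theorem stub_onFrontierFarPerShellTight :
    ∀ (D : DobrushinDomain) (a b : ℝ → HexVertex), IsEmbEndpointApprox hexGraph hexCenter D a b →
      ∀ (x : ℂ) (ρ R : ℝ), 0 < ρ → 4 * ρ < R → R ≤ 1 → x ∈ frontier D.carrier →
        R < dist x (D.pt 0) → R < dist x (D.pt 1) → ∀ η : ℝ, 0 < η →
        ∃ (k : ℕ) (δ₁ : ℝ), 0 < δ₁ ∧ ∀ δ ∈ Set.Ioc (0 : ℝ) δ₁, δ ≤ ρ →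
          hexSAWLaw D.carrier δ (a δ) (b δ)
            {γ | (⟨γ.walk.toCurve fun v => (δ : ℂ) * hexCenter v⟩ : Curve ℂ).HasTraversals k x ρ R} ≤
            ENNReal.ofReal η := by
  sorry

/-! ## The dodge (LANDED, p118802, `Theorems/SAWDevelopingMapHexTightOnFrontierFar.lean`)

`BoundaryOnFrontier.window_disjoint`, `BoundaryOnFrontier.onFrontierAspect_of_interiorThin_of_onFrontierFar` (over
`stub_netNear`, p118567), `onFrontier_of_interiorThin_of_onFrontierFar`, `hexTight_of_pinchDecay_of_onFrontierFar`,
`hexTight_iff_interiorThin_and_onFrontierFar` are imported. -/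

/-! ## The checked composition (r9) -/

/-- **The line concludes the crux** (`<Crux>_of`, sorry-free; every hypothesis a named stub statement): pinch decay +
on-frontier per-shell tightness far from the marked points ⇒ `HexTight`. This is exactly the landed
`BoundaryOnFrontier.hexTight_of_pinchDecay_of_onFrontierFar` (p118802: `interiorThinPerShellTight_of_pinchDecay`, the
dodge over `stub_netNear` at `p₀ = D.pt 0`, `p₁ = D.pt 1`, `perShellTight_thin_of_onFrontierAspect 100`,
`hexTight_of_interiorThin_of_onFrontier`). -/
theorem HexTight_of :
    PinchDecay → OnFrontierFarPerShellTight →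
    Summit.CriticalPhenomena.SAWScalingLimit.Theses.SAWDevelopingMap.HexTight :=
  fun hC hFar => hexTight_of_pinchDecay_of_onFrontierFar hC hFar

/-- The same, fed with the two registered stubs (the only `sorry`s of this file). -/
theorem HexTight_skeleton :
    Summit.CriticalPhenomena.SAWScalingLimit.Theses.SAWDevelopingMap.HexTight :=
  HexTight_of stub_pinchDecay stub_onFrontierFarPerShellTight

/-- Skeleton-checker entry point: the crux under its ledger-default decl name (route `SAWResidueField`;
the decl is shared VERBATIM with `SAWDevelopingMap.HexTight`). -/
theorem HexTight_proof :
    Summit.CriticalPhenomena.SAWScalingLimit.Theses.SAWResidueField.HexTight :=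
  fun D a b hab => HexTight_skeleton D a b hab

/-! ## Earlier compositions survive -/

/-- r8's composition (LANDED as `Reversal.hexTight_of_pinchDecay_of_onFrontierPerShellTight`, p118066): pinch decay +
the unrestricted boundary atom ⇒ `HexTight`. -/
theorem HexTight_of_r8 : PinchDecay → OnFrontierPerShellTight →
    Summit.CriticalPhenomena.SAWScalingLimit.Theses.SAWDevelopingMap.HexTight :=
  fun hC hF => hexTight_of_pinchDecay_of_onFrontierPerShellTight hC hF

/-- r7's composition (LANDED as `Reversal.hexTight_of_arcPinchBound_of_onFrontierPerShellTight`, p118066). -/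
theorem HexTight_of_r7 : ArcPinchBound → OnFrontierPerShellTight →
    Summit.CriticalPhenomena.SAWScalingLimit.Theses.SAWDevelopingMap.HexTight :=
  fun hC hF => hexTight_of_arcPinchBound_of_onFrontierPerShellTight hC hF

/-- **`HexTight` from its two verbatim pieces** (law-level twin): thin-interior per-shell tightness and on-frontier
per-shell tightness conclude the crux, and conversely (`BoundaryOnFrontier.hexTight_iff_interiorThin_and_onFrontier`,
p111202). -/
theorem HexTight_iff_pieces : Summit.CriticalPhenomena.SAWScalingLimit.Theses.SAWDevelopingMap.HexTight ↔
    InteriorThinPerShellTight ∧ OnFrontierPerShellTight :=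
  hexTight_iff_interiorThin_and_onFrontier

/-- **`HexTight` ⟺ (thin-interior per-shell tightness) ∧ (on-frontier per-shell tightness far from the marked
points)** — the r9 sharpening, LANDED as `BoundaryOnFrontier.hexTight_iff_interiorThin_and_onFrontierFar` (p118802). -/
theorem HexTight_iff_pieces_far : Summit.CriticalPhenomena.SAWScalingLimit.Theses.SAWDevelopingMap.HexTight ↔
    InteriorThinPerShellTight ∧ OnFrontierFarPerShellTight :=
  hexTight_iff_interiorThin_and_onFrontierFar

/-- The far-from-marks boundary atom is still a piece of the crux (restriction of `perShellTight_of_hexTight`). -/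
theorem onFrontierFar_of_HexTight :
    Summit.CriticalPhenomena.SAWScalingLimit.Theses.SAWDevelopingMap.HexTight → OnFrontierFarPerShellTight :=
  fun h D a b hab x ρ R hρ h4 hR1 hx _ _ η hη => (hexTight_iff_interiorThin_and_onFrontier.1 h).2 D a b hab x ρ R
    hρ h4 hR1 hx η hη

end Summit.CriticalPhenomena.SAWScalingLimit.Cruxes.HexTight.ReversalVirginDisc

end
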